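import Summits.MatrixMultiplication.MatrixMultiplication.Theorems.SoloInformedValGridLemma

/-!
# The pair inequality for coset classes

Setting of `SoloInformedValGridLemma` (finite abelian group `G`, identity potentials, a family of complete blocks,
the family criterion `M_t ⊥ U_t ⊥ V_t` at a block `t` and its mirror form for the `Y ↔ Z` swapped family).

Fix two blocks `t ≠ u`.  Let `R₁` be a period of `Y_t − Z_t`, and let `B`, `C` be periods of `Y_u`, `Z_u`
(finite sets closed under subtraction with `Y_u + B ⊆ Y_u`, `Z_u + C ⊆ Z_u`); put
`W = R₁ + (B + C)`, `W₁ = R₁ + B`, `W₁' = R₁ + C`, `A = X_t + W`, and for elements `y_t ∈ Y_t, z_t ∈ Z_t, y_u ∈ Y_u,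
z_u ∈ Z_u` put `e = (y_u − z_u) − (y_t − z_t)`.

* `criterion_disjoint_translate` : `A ∩ (A + e) = ∅` (grid lemma on `M_t ⊥ X_t + (Y_u − Z_u)`).
* `criterion_disjoint_V` : `(X_u + (z_t − z_u) + W₁') ∩ (X_t + W₁') = ∅` (grid lemma on `V_t ⊥ M_t`, the part
  `y_t + X_u − Z_u` of `V_t` being `C`-saturated).
* `criterion_disjoint_mirrorV` : `(X_u + (y_t − y_u) + W₁) ∩ (X_t + W₁) = ∅` (the same for the mirror criterion).
* `pair_inequality_core` : from these three facts alone,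
  `|W₁|·|W₁'|·|X_u + W| + 2·|W₁|·|W₁'|·|A| ≤ |W₁|·|W₁'|·|G| + |W₁|·|W|·|A ∖ (X_t + W₁')| + |W₁'|·|W|·|A ∖ (X_t + W₁)|`.
  Reading in `G/W` (pure subspace designs, `|W₁| = 2^{β'}|R_t|`, `|W₁'| = 2^{γ'}|R_t|`, `|W| = 2^δ|R_t|`): with
  `f_t = 2^δ|A/W| − |X_t|` this is `x_u + 2x_t ≤ N + f_t(2^{δ−β'} + 2^{δ−γ'} − 2)` (dossier §15.8 (n)(xx ζ)).
* `FamilyCriterionAt.pair_inequality` : the assembled statement under the criterion and its mirror at `t`.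

Proof of the core count: `X_u + (z_t − z_u) + W` is the `e`-translate of `X_u + (y_t − y_u) + W`; split it along
`G = A ⊔ (A + e) ⊔ rest`; its part in `A` lies in `(A ∖ (X_t + W₁')) + W` (a point of `A` hit by it has a
`W₁'`-saturated preimage missing `X_t + W₁'`), its part in `A + e` is the translate of the part of
`X_u + (y_t − y_u) + W` in `A`, which lies in `(A ∖ (X_t + W₁)) + W`; and a `W₁`-saturated set `S` has
`|W₁|·|S + W| ≤ |S|·|W|`.
-/

namespace Summit.MatrixMultiplication.MatrixMultiplication.Theorems.SoloVal

open Finset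

section PairInequality

variable {G : Type*} [AddCommGroup G] [DecidableEq G]

/-! ### Small sumset facts -/

/-- Monotonicity of the sumset in the second argument. -/
theorem sumSet_mono_right {A B B' : Finset G} (h : B ⊆ B') : sumSet A B ⊆ sumSet A B' := by
  intro g hg
  obtain ⟨a, ha, b, hb, rfl⟩ := mem_sumSet.mp hg
  exact mem_sumSet.mpr ⟨a, ha, b, h hb, rfl⟩

/-- Monotonicity of the sumset in the first argument. -/
theorem sumSet_mono_left {A A' B : Finset G} (h : A ⊆ A') : sumSet A B ⊆ sumSet A' B := by
  intro g hg
  obtain ⟨a, ha, b, hb, rfl⟩ := mem_sumSet.mp hg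
  exact mem_sumSet.mpr ⟨a, h ha, b, hb, rfl⟩

/-- The sumset of two sets closed under subtraction is closed under subtraction. -/
theorem sumSet_subClosed {R S : Finset G} (hR : ∀ r ∈ R, ∀ s ∈ R, r - s ∈ R)
    (hS : ∀ r ∈ S, ∀ s ∈ S, r - s ∈ S) :
    ∀ r ∈ sumSet R S, ∀ s ∈ sumSet R S, r - s ∈ sumSet R S := by
  intro w hw w' hw'
  obtain ⟨r, hr, s, hs, rfl⟩ := mem_sumSet.mp hw
  obtain ⟨r', hr', s', hs', rfl⟩ := mem_sumSet.mp hw'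
  exact mem_sumSet.mpr ⟨r - r', hR r hr r' hr', s - s', hS s hs s' hs', by abel⟩

/-- `R + B ⊆ R + (B + C)` when `0 ∈ C`. -/
theorem sumSet_subset_sumSet_sumSet_left {R B C : Finset G} (h0 : (0 : G) ∈ C) :
    sumSet R B ⊆ sumSet R (sumSet B C) :=
  sumSet_mono_right fun b hb => mem_sumSet.mpr ⟨b, hb, 0, h0, add_zero b⟩

/-- `R + C ⊆ R + (B + C)` when `0 ∈ B`. -/
theorem sumSet_subset_sumSet_sumSet_right {R B C : Finset G} (h0 : (0 : G) ∈ B) :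
    sumSet R C ⊆ sumSet R (sumSet B C) :=
  sumSet_mono_right fun c hc => mem_sumSet.mpr ⟨0, h0, c, hc, zero_add c⟩

/-- Translating the first summand translates the sumset. -/
theorem sumSet_image_add_eq (X₀ W : Finset G) (a : G) :
    sumSet (X₀.image fun x => x + a) W = (sumSet X₀ W).image fun g => g + a := by
  ext g
  rw [mem_sumSet, Finset.mem_image]
  constructor
  · rintro ⟨x', hx', w, hw, rfl⟩
    obtain ⟨x, hx, rfl⟩ := Finset.mem_image.mp hx'
    exact ⟨x + w, mem_sumSet.mpr ⟨x, hx, w, hw, rfl⟩, by abel⟩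
  · rintro ⟨g₀, hg₀, rfl⟩
    obtain ⟨x, hx, w, hw, rfl⟩ := mem_sumSet.mp hg₀
    exact ⟨x + a, Finset.mem_image.mpr ⟨x, hx, rfl⟩, w, hw, by abel⟩

/-- Double translation. -/
theorem sumSet_image_add_add (X₀ W : Finset G) (a b : G) :
    sumSet (X₀.image fun x => x + (a + b)) W = (sumSet (X₀.image fun x => x + a) W).image fun g => g + b := by
  rw [sumSet_image_add_eq, sumSet_image_add_eq, Finset.image_image]
  apply Finset.image_congr
  intro g _
  show g + (a + b) = (g + a) + b
  abel

/-- A sumset with `W` is `W`-saturated when `W` is closed under subtraction. -/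
theorem sumSet_sat_self {X₀ W : Finset G} (hW : ∀ r ∈ W, ∀ s ∈ W, r - s ∈ W) :
    ∀ m ∈ sumSet X₀ W, ∀ r ∈ W, m + r ∈ sumSet X₀ W := by
  intro m hm r hr
  obtain ⟨x, hx, w, hw, rfl⟩ := mem_sumSet.mp hm
  have h0 : (0 : G) ∈ W := subClosed_zero_mem hW ⟨r, hr⟩
  exact mem_sumSet.mpr ⟨x, hx, w - (0 - r), hW w hw _ (hW 0 h0 r hr), by abel⟩

/-! ### The two counting lemmas -/

/-- COSET COUNT: if `S` is `W₁`-saturated with `W₁ ⊆ W` (`W` closed under subtraction), then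
`|W₁|·|S + W| ≤ |S|·|W|` (every element of `S + W` has at least `|W₁|` representations). -/
theorem card_mul_card_sumSet_le_of_sat {S W W₁ : Finset G} (hW : ∀ r ∈ W, ∀ s ∈ W, r - s ∈ W)
    (hW₁W : W₁ ⊆ W) (hS : ∀ m ∈ S, ∀ b ∈ W₁, m + b ∈ S) :
    W₁.card * (sumSet S W).card ≤ S.card * W.card := by
  have h := Finset.mul_card_image_le_card (f := fun p : G × G => p.1 + p.2) (S ×ˢ W) W₁.card ?_
  · rw [Finset.card_product] at h
    exact h
  · intro g hg
    obtain ⟨⟨m₀, w₀⟩, hm, rfl⟩ := Finset.mem_image.mp hg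
    rw [Finset.mem_product] at hm
    have hinj : Set.InjOn (fun b : G => (m₀ + b, w₀ - b)) ↑W₁ := by
      intro b _ b' _ heq
      have h1 := congrArg Prod.fst heq
      exact add_left_cancel h1
    calc W₁.card = (W₁.image fun b => (m₀ + b, w₀ - b)).card := (Finset.card_image_of_injOn hinj).symm
      _ ≤ _ := by
        apply Finset.card_le_card
        intro p hp
        obtain ⟨b, hb, rfl⟩ := Finset.mem_image.mp hp
        rw [Finset.mem_filter, Finset.mem_product]
        refine ⟨⟨hS m₀ hm.1 b hb, hW w₀ hm.2 b (hW₁W hb)⟩, ?_⟩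
        show m₀ + b + (w₀ - b) = m₀ + w₀
        abel

/-- MISS LEMMA: if `P + W₁` is disjoint from `X + W₁` (`0 ∈ W₁`, `W` closed under subtraction), then the part of
`P + W` inside `X + W` lies in `((X + W) ∖ (X + W₁)) + W`. -/
theorem inter_sumSet_subset_sdiff_sumSet {P X₀ W W₁ : Finset G} (hW : ∀ r ∈ W, ∀ s ∈ W, r - s ∈ W)
    (h0 : (0 : G) ∈ W₁) (hdisj : Disjoint (sumSet P W₁) (sumSet X₀ W₁)) :
    sumSet P W ∩ sumSet X₀ W ⊆ sumSet (sumSet X₀ W \ sumSet X₀ W₁) W := by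
  intro g hg
  rw [Finset.mem_inter] at hg
  obtain ⟨p, hp, w, hw, rfl⟩ := mem_sumSet.mp hg.1
  obtain ⟨x, hx, w', hw', hEq⟩ := mem_sumSet.mp hg.2
  have hpA : p ∈ sumSet X₀ W := mem_sumSet.mpr ⟨x, hx, w' - w, hW w' hw' w hw, by
    calc x + (w' - w) = (x + w') - w := by abel
      _ = (p + w) - w := by rw [hEq]
      _ = p := by abel⟩
  have hpN : p ∉ sumSet X₀ W₁ := by
    intro hp'
    exact Finset.disjoint_left.mp hdisj (mem_sumSet.mpr ⟨p, hp, 0, h0, add_zero p⟩) hp'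
  exact mem_sumSet.mpr ⟨p, Finset.mem_sdiff.mpr ⟨hpA, hpN⟩, w, hw, rfl⟩

/-- The 'miss' set `(X + W) ∖ (X + W₁)` is `W₁`-saturated. -/
theorem sdiff_sumSet_sat {X₀ W W₁ : Finset G} (hW : ∀ r ∈ W, ∀ s ∈ W, r - s ∈ W)
    (hW₁ : ∀ r ∈ W₁, ∀ s ∈ W₁, r - s ∈ W₁) (hW₁W : W₁ ⊆ W) :
    ∀ m ∈ sumSet X₀ W \ sumSet X₀ W₁, ∀ b ∈ W₁, m + b ∈ sumSet X₀ W \ sumSet X₀ W₁ := by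
  intro m hm b hb
  rw [Finset.mem_sdiff] at hm ⊢
  refine ⟨sumSet_sat_self hW m hm.1 b (hW₁W hb), ?_⟩
  intro hmb
  obtain ⟨x, hx, b', hb', hEq⟩ := mem_sumSet.mp hmb
  exact hm.2 (mem_sumSet.mpr ⟨x, hx, b' - b, hW₁ b' hb' b hb, by
    calc x + (b' - b) = (x + b') - b := by abel
      _ = (m + b) - b := by rw [hEq]
      _ = m := by abel⟩)

/-! ### The core count -/

/-- PAIR INEQUALITY, core form: see the module docstring. -/
theorem pair_inequality_core [Fintype G] {Xt Xu W W₁ W₁' : Finset G} {a e c : G}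
    (hW : ∀ r ∈ W, ∀ s ∈ W, r - s ∈ W) (hW₁ : ∀ r ∈ W₁, ∀ s ∈ W₁, r - s ∈ W₁)
    (hW₁' : ∀ r ∈ W₁', ∀ s ∈ W₁', r - s ∈ W₁') (hW₁W : W₁ ⊆ W) (hW₁'W : W₁' ⊆ W)
    (h0 : (0 : G) ∈ W₁) (h0' : (0 : G) ∈ W₁') (hc : c = a + e)
    (hA : Disjoint (sumSet Xt W) ((sumSet Xt W).image fun g => g + e))
    (hVa : Disjoint (sumSet (Xu.image fun x => x + a) W₁) (sumSet Xt W₁))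
    (hVc : Disjoint (sumSet (Xu.image fun x => x + c) W₁') (sumSet Xt W₁')) :
    W₁.card * W₁'.card * (sumSet Xu W).card + 2 * (W₁.card * W₁'.card * (sumSet Xt W).card) ≤
      W₁.card * W₁'.card * Fintype.card G + W₁.card * W.card * (sumSet Xt W \ sumSet Xt W₁').card +
        W₁'.card * W.card * (sumSet Xt W \ sumSet Xt W₁).card := by
  subst hc
  set A := sumSet Xt W with hAdef
  set Ae := A.image (fun g => g + e) with hAe
  set Pa := sumSet (Xu.image fun x => x + a) W with hPa
  set Pc := sumSet (Xu.image fun x => x + (a + e)) W with hPc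
  set Miss := sumSet Xt W \ sumSet Xt W₁ with hMiss
  set Miss' := sumSet Xt W \ sumSet Xt W₁' with hMiss'
  have hPc_eq : Pc = Pa.image (fun g => g + e) := sumSet_image_add_add Xu W a e
  -- cardinalities of translates
  have hPc_card : Pc.card = (sumSet Xu W).card := by
    rw [hPc, sumSet_image_add_eq]; exact Finset.card_image_of_injective _ (add_left_injective _)
  have hAe_card : Ae.card = A.card := Finset.card_image_of_injective _ (add_left_injective _)
  -- the three-way split of `Pc`
  have hsplit : Pc ⊆ (Pc ∩ A) ∪ (Pc ∩ Ae) ∪ (Pc \ (A ∪ Ae)) := by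
    intro g hg
    by_cases h1 : g ∈ A
    · exact Finset.mem_union_left _ (Finset.mem_union_left _ (Finset.mem_inter.mpr ⟨hg, h1⟩))
    by_cases h2 : g ∈ Ae
    · exact Finset.mem_union_left _ (Finset.mem_union_right _ (Finset.mem_inter.mpr ⟨hg, h2⟩))
    · refine Finset.mem_union_right _ (Finset.mem_sdiff.mpr ⟨hg, ?_⟩)
      rw [Finset.mem_union, not_or]; exact ⟨h1, h2⟩
  have hcard_split : Pc.card ≤ (Pc ∩ A).card + (Pc ∩ Ae).card + (Pc \ (A ∪ Ae)).card :=
    (Finset.card_le_card hsplit).trans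
      ((Finset.card_union_le _ _).trans (Nat.add_le_add_right (Finset.card_union_le _ _) _))
  -- the rest plus `A ⊔ Ae` fits in `G`
  have hrest : (Pc \ (A ∪ Ae)).card + 2 * A.card ≤ Fintype.card G := by
    have hAAe : (A ∪ Ae).card = 2 * A.card := by
      rw [Finset.card_union_of_disjoint hA, hAe_card]; ring
    have hd : Disjoint (Pc \ (A ∪ Ae)) (A ∪ Ae) := Finset.sdiff_disjoint
    calc (Pc \ (A ∪ Ae)).card + 2 * A.card = ((Pc \ (A ∪ Ae)) ∪ (A ∪ Ae)).card := by
          rw [Finset.card_union_of_disjoint hd, hAAe]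
      _ ≤ Fintype.card G := Finset.card_le_univ _
  -- part in `A`: through `Miss'`
  have hI1 : (Pc ∩ A).card ≤ (sumSet Miss' W).card :=
    Finset.card_le_card (inter_sumSet_subset_sdiff_sumSet hW h0' hVc)
  have hM1 : W₁'.card * (sumSet Miss' W).card ≤ Miss'.card * W.card :=
    card_mul_card_sumSet_le_of_sat hW hW₁'W (sdiff_sumSet_sat hW hW₁' hW₁'W)
  -- part in `Ae`: translate of the part of `Pa` in `A`, through `Miss`
  have hI2eq : Pc ∩ Ae = (Pa ∩ A).image (fun g => g + e) := by
    rw [hPc_eq, hAe, Finset.image_inter _ _ (add_left_injective e)]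
  have hI2 : (Pc ∩ Ae).card ≤ (sumSet Miss W).card := by
    rw [hI2eq, Finset.card_image_of_injective _ (add_left_injective e)]
    exact Finset.card_le_card (inter_sumSet_subset_sdiff_sumSet hW h0 hVa)
  have hM2 : W₁.card * (sumSet Miss W).card ≤ Miss.card * W.card :=
    card_mul_card_sumSet_le_of_sat hW hW₁W (sdiff_sumSet_sat hW hW₁ hW₁W)
  -- bookkeeping
  have hJ1 : W₁'.card * (Pc ∩ A).card ≤ Miss'.card * W.card :=
    (Nat.mul_le_mul_left _ hI1).trans hM1
  have hJ2 : W₁.card * (Pc ∩ Ae).card ≤ Miss.card * W.card :=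
    (Nat.mul_le_mul_left _ hI2).trans hM2
  have H1 : W₁.card * W₁'.card * Pc.card ≤
      W₁.card * (Miss'.card * W.card) + W₁'.card * (Miss.card * W.card) +
        W₁.card * W₁'.card * (Pc \ (A ∪ Ae)).card :=
    calc W₁.card * W₁'.card * Pc.card
        ≤ W₁.card * W₁'.card * ((Pc ∩ A).card + (Pc ∩ Ae).card + (Pc \ (A ∪ Ae)).card) :=
          Nat.mul_le_mul_left _ hcard_split
      _ = W₁.card * (W₁'.card * (Pc ∩ A).card) + W₁'.card * (W₁.card * (Pc ∩ Ae).card) +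
            W₁.card * W₁'.card * (Pc \ (A ∪ Ae)).card := by ring
      _ ≤ W₁.card * (Miss'.card * W.card) + W₁'.card * (Miss.card * W.card) +
            W₁.card * W₁'.card * (Pc \ (A ∪ Ae)).card :=
          Nat.add_le_add_right (Nat.add_le_add (Nat.mul_le_mul_left _ hJ1) (Nat.mul_le_mul_left _ hJ2)) _
  have H2 : W₁.card * W₁'.card * ((Pc \ (A ∪ Ae)).card + 2 * A.card) ≤
      W₁.card * W₁'.card * Fintype.card G := Nat.mul_le_mul_left _ hrest
  rw [hPc_card] at H1
  nlinarith [H1, H2]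

/-! ### The three disjointness facts under the criterion -/

variable {ι : Type*} [DecidableEq ι] {T : Finset ι} {X Y Z : ι → Finset G} {t u : ι}

/-- `A ∩ (A + e) = ∅` for `A = X_t + (R₁ + R₂)`, `e = (y_u − z_u) − (y_t − z_t)`. -/
theorem FamilyCriterionAt.disjoint_translate (h : FamilyCriterionAt T X Y Z t) {R₁ R₂ : Finset G}
    (hR₁ : ∀ r ∈ R₁, ∀ s ∈ R₁, r - s ∈ R₁) (hR₂ : ∀ r ∈ R₂, ∀ s ∈ R₂, r - s ∈ R₂)
    (hsat₁ : ∀ d ∈ diffSet (Y t) (Z t), ∀ r ∈ R₁, d + r ∈ diffSet (Y t) (Z t))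
    (hsat₂ : ∀ d ∈ diffSet (Y u) (Z u), ∀ r ∈ R₂, d + r ∈ diffSet (Y u) (Z u))
    (hu : u ∈ T) (hut : u ≠ t) {yt zt yu zu : G} (hyt : yt ∈ Y t) (hzt : zt ∈ Z t)
    (hyu : yu ∈ Y u) (hzu : zu ∈ Z u) :
    Disjoint (sumSet (X t) (sumSet R₁ R₂))
      ((sumSet (X t) (sumSet R₁ R₂)).image fun g => g + ((yu - zu) - (yt - zt))) := by
  set W := sumSet R₁ R₂ with hW
  set M := sumSet (X t) (diffSet (Y t) (Z t)) with hM
  set P := sumSet (X t) (diffSet (Y u) (Z u)) with hP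
  have hMP : Disjoint M P := by
    have hMU := h.2.1
    rw [mixedImage_eq_sumSet_diffSet] at hMU
    refine Finset.disjoint_of_subset_right ?_ hMU
    intro g hg
    obtain ⟨x, hx, d, hd, rfl⟩ := mem_sumSet.mp hg
    obtain ⟨y, hy, z, hz, rfl⟩ := mem_diffSet.mp hd
    exact mem_crossU.mpr ⟨x, hx, u, Finset.mem_erase.mpr ⟨hut, hu⟩, y, hy, z, hz, rfl⟩
  have hgrid : Disjoint (sumSet M W) (sumSet P W) :=
    grid_disjoint hR₁ hR₂ (sumSet_sat hsat₁) (sumSet_sat hsat₂) hMP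
  have hdt : yt - zt ∈ diffSet (Y t) (Z t) := mem_diffSet.mpr ⟨yt, hyt, zt, hzt, rfl⟩
  have hdu : yu - zu ∈ diffSet (Y u) (Z u) := mem_diffSet.mpr ⟨yu, hyu, zu, hzu, rfl⟩
  rw [Finset.disjoint_left]
  intro g hg hg'
  obtain ⟨g₀, hg₀, hge⟩ := Finset.mem_image.mp hg'
  -- `g + (yt - zt)` lies in `M + W` and, as `g₀ + (yu - zu)`, in `P + W`
  have h1 : g + (yt - zt) ∈ sumSet M W :=
    image_sumSet_translate_subset hdt (Finset.mem_image.mpr ⟨g, hg, rfl⟩)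
  have h2 : g₀ + (yu - zu) ∈ sumSet P W :=
    image_sumSet_translate_subset hdu (Finset.mem_image.mpr ⟨g₀, hg₀, rfl⟩)
  have heq : g₀ + (yu - zu) = g + (yt - zt) := by rw [← hge]; abel
  rw [heq] at h2
  exact Finset.disjoint_left.mp hgrid h1 h2

/-- `(X_u + (z_t − z_u) + W₁') ∩ (X_t + W₁') = ∅` with `W₁' = R₁ + C`, `C` a period of `Z_u`
(from `V_t ⊥ M_t`). -/
theorem FamilyCriterionAt.disjoint_V (h : FamilyCriterionAt T X Y Z t) {R₁ C : Finset G}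
    (hR₁ : ∀ r ∈ R₁, ∀ s ∈ R₁, r - s ∈ R₁) (hC : ∀ r ∈ C, ∀ s ∈ C, r - s ∈ C)
    (hsat₁ : ∀ d ∈ diffSet (Y t) (Z t), ∀ r ∈ R₁, d + r ∈ diffSet (Y t) (Z t))
    (hCZ : ∀ z ∈ Z u, ∀ c ∈ C, z + c ∈ Z u)
    (hu : u ∈ T) (hut : u ≠ t) {yt zt zu : G} (hyt : yt ∈ Y t) (hzt : zt ∈ Z t) (hzu : zu ∈ Z u) :
    Disjoint (sumSet ((X u).image fun x => x + (zt - zu)) (sumSet R₁ C)) (sumSet (X t) (sumSet R₁ C)) := by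
  set W₁' := sumSet R₁ C with hW₁'
  set M := sumSet (X t) (diffSet (Y t) (Z t)) with hM
  -- the `C`-saturated part `y_t + X_u − Z_u` of `V_t`
  set V' := sumSet (X u) ((Z u).image fun z => yt - z) with hV'
  have hMV : Disjoint M V' := by
    have hMV := h.2.2.1
    rw [mixedImage_eq_sumSet_diffSet] at hMV
    refine Finset.disjoint_of_subset_right ?_ hMV
    intro g hg
    obtain ⟨x, hx, d, hd, rfl⟩ := mem_sumSet.mp hg
    obtain ⟨z, hz, rfl⟩ := Finset.mem_image.mp hd
    exact mem_crossV.mpr ⟨yt, hyt, u, Finset.mem_erase.mpr ⟨hut, hu⟩, x, hx, z, hz, by abel⟩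
  have hV'sat : ∀ m ∈ V', ∀ c ∈ C, m + c ∈ V' := by
    intro m hm c hc
    obtain ⟨x, hx, d, hd, rfl⟩ := mem_sumSet.mp hm
    obtain ⟨z, hz, rfl⟩ := Finset.mem_image.mp hd
    have hzc : z + -c ∈ Z u := hCZ z hz (-c) (subClosed_neg_mem hC hc)
    exact mem_sumSet.mpr ⟨x, hx, yt - (z + -c), Finset.mem_image.mpr ⟨z + -c, hzc, rfl⟩, by abel⟩
  have hgrid : Disjoint (sumSet M W₁') (sumSet V' W₁') :=
    grid_disjoint hR₁ hC (sumSet_sat hsat₁) hV'sat hMV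
  have hdt : yt - zt ∈ diffSet (Y t) (Z t) := mem_diffSet.mpr ⟨yt, hyt, zt, hzt, rfl⟩
  -- translate everything by `yt - zt`
  rw [Finset.disjoint_left]
  intro g hg hg'
  have h1 : g + (yt - zt) ∈ sumSet M W₁' :=
    image_sumSet_translate_subset hdt (Finset.mem_image.mpr ⟨g, hg', rfl⟩)
  have h2 : g + (yt - zt) ∈ sumSet V' W₁' := by
    obtain ⟨x', hx', w, hw, rfl⟩ := mem_sumSet.mp hg
    obtain ⟨x, hx, rfl⟩ := Finset.mem_image.mp hx'
    exact mem_sumSet.mpr ⟨x + (yt - zu), mem_sumSet.mpr ⟨x, hx, yt - zu,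
      Finset.mem_image.mpr ⟨zu, hzu, rfl⟩, rfl⟩, w, hw, by abel⟩
  exact Finset.disjoint_left.mp hgrid h1 h2

/-- `(X_u + (y_t − y_u) + W₁) ∩ (X_t + W₁) = ∅` with `W₁ = R₁ + B`, `B` a period of `Y_u`
(from the MIRROR criterion `Ṽ_t ⊥ M̃_t`, i.e. the criterion of the `Y ↔ Z` swapped family at `t`). -/
theorem FamilyCriterionAt.disjoint_mirrorV (h' : FamilyCriterionAt T X Z Y t) {R₁ B : Finset G}
    (hR₁ : ∀ r ∈ R₁, ∀ s ∈ R₁, r - s ∈ R₁) (hB : ∀ r ∈ B, ∀ s ∈ B, r - s ∈ B)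
    (hsat₁ : ∀ d ∈ diffSet (Y t) (Z t), ∀ r ∈ R₁, d + r ∈ diffSet (Y t) (Z t))
    (hBY : ∀ y ∈ Y u, ∀ b ∈ B, y + b ∈ Y u)
    (hu : u ∈ T) (hut : u ≠ t) {yt zt yu : G} (hyt : yt ∈ Y t) (hzt : zt ∈ Z t) (hyu : yu ∈ Y u) :
    Disjoint (sumSet ((X u).image fun x => x + (yt - yu)) (sumSet R₁ B)) (sumSet (X t) (sumSet R₁ B)) := by
  have hsat₁' : ∀ d ∈ diffSet (Z t) (Y t), ∀ r ∈ R₁, d + r ∈ diffSet (Z t) (Y t) :=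
    diffSet_swap_sat hR₁ hsat₁
  have hd := h'.disjoint_V (X := X) (Y := Z) (Z := Y) hR₁ hB hsat₁' hBY hu hut hzt hyt hyu
  exact hd

/-! ### Assembly -/

/-- THE PAIR INEQUALITY under the family criterion and its mirror at `t` (coset classes at `u`, a period `R₁` of
`Y_t − Z_t`): with `W = R₁ + (B + C)`, `W₁ = R₁ + B`, `W₁' = R₁ + C`,
`|W₁|·|W₁'|·|X_u + W| + 2·|W₁|·|W₁'|·|X_t + W| ≤ |W₁|·|W₁'|·|G| + |W₁|·|W|·|(X_t + W) ∖ (X_t + W₁')| +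
 |W₁'|·|W|·|(X_t + W) ∖ (X_t + W₁)|`. -/
theorem FamilyCriterionAt.pair_inequality [Fintype G] (h : FamilyCriterionAt T X Y Z t)
    (h' : FamilyCriterionAt T X Z Y t) {R₁ B C : Finset G}
    (hR₁ : ∀ r ∈ R₁, ∀ s ∈ R₁, r - s ∈ R₁) (hB : ∀ r ∈ B, ∀ s ∈ B, r - s ∈ B)
    (hC : ∀ r ∈ C, ∀ s ∈ C, r - s ∈ C) (hR₁ne : R₁.Nonempty) (hBne : B.Nonempty) (hCne : C.Nonempty)
    (hsat₁ : ∀ d ∈ diffSet (Y t) (Z t), ∀ r ∈ R₁, d + r ∈ diffSet (Y t) (Z t))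
    (hBY : ∀ y ∈ Y u, ∀ b ∈ B, y + b ∈ Y u) (hCZ : ∀ z ∈ Z u, ∀ c ∈ C, z + c ∈ Z u)
    (hu : u ∈ T) (hut : u ≠ t) {yt zt yu zu : G} (hyt : yt ∈ Y t) (hzt : zt ∈ Z t)
    (hyu : yu ∈ Y u) (hzu : zu ∈ Z u) :
    (sumSet R₁ B).card * (sumSet R₁ C).card * (sumSet (X u) (sumSet R₁ (sumSet B C))).card +
        2 * ((sumSet R₁ B).card * (sumSet R₁ C).card * (sumSet (X t) (sumSet R₁ (sumSet B C))).card) ≤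
      (sumSet R₁ B).card * (sumSet R₁ C).card * Fintype.card G +
        (sumSet R₁ B).card * (sumSet R₁ (sumSet B C)).card *
          (sumSet (X t) (sumSet R₁ (sumSet B C)) \ sumSet (X t) (sumSet R₁ C)).card +
        (sumSet R₁ C).card * (sumSet R₁ (sumSet B C)).card *
          (sumSet (X t) (sumSet R₁ (sumSet B C)) \ sumSet (X t) (sumSet R₁ B)).card := by
  have h0R : (0 : G) ∈ R₁ := subClosed_zero_mem hR₁ hR₁ne
  have h0B : (0 : G) ∈ B := subClosed_zero_mem hB hBne
  have h0C : (0 : G) ∈ C := subClosed_zero_mem hC hCne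
  have hBC : ∀ r ∈ sumSet B C, ∀ s ∈ sumSet B C, r - s ∈ sumSet B C := sumSet_subClosed hB hC
  have hW : ∀ r ∈ sumSet R₁ (sumSet B C), ∀ s ∈ sumSet R₁ (sumSet B C), r - s ∈ sumSet R₁ (sumSet B C) :=
    sumSet_subClosed hR₁ hBC
  have hW₁ := sumSet_subClosed hR₁ hB
  have hW₁' := sumSet_subClosed hR₁ hC
  have hW₁W : sumSet R₁ B ⊆ sumSet R₁ (sumSet B C) := sumSet_subset_sumSet_sumSet_left h0C
  have hW₁'W : sumSet R₁ C ⊆ sumSet R₁ (sumSet B C) := sumSet_subset_sumSet_sumSet_right h0B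
  have h01 : (0 : G) ∈ sumSet R₁ B := mem_sumSet.mpr ⟨0, h0R, 0, h0B, add_zero 0⟩
  have h01' : (0 : G) ∈ sumSet R₁ C := mem_sumSet.mpr ⟨0, h0R, 0, h0C, add_zero 0⟩
  -- `B + C` is a period of `Y_u − Z_u`
  have hsat₂ : ∀ d ∈ diffSet (Y u) (Z u), ∀ r ∈ sumSet B C, d + r ∈ diffSet (Y u) (Z u) := by
    intro d hd r hr
    obtain ⟨y, hy, z, hz, rfl⟩ := mem_diffSet.mp hd
    obtain ⟨b, hb, c, hc, rfl⟩ := mem_sumSet.mp hr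
    have hzc : z + -c ∈ Z u := hCZ z hz (-c) (subClosed_neg_mem hC hc)
    exact mem_diffSet.mpr ⟨y + b, hBY y hy b hb, z + -c, hzc, by abel⟩
  have hA := h.disjoint_translate hR₁ hBC hsat₁ hsat₂ hu hut hyt hzt hyu hzu
  have hVa := h'.disjoint_mirrorV hR₁ hB hsat₁ hBY hu hut hyt hzt hyu
  have hVc := h.disjoint_V hR₁ hC hsat₁ hCZ hu hut hyt hzt hzu
  exact pair_inequality_core hW hW₁ hW₁' hW₁W hW₁'W h01 h01' (a := yt - yu) (e := (yu - zu) - (yt - zt))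
    (c := zt - zu) (by abel) hA hVa hVc

end PairInequality

end Summit.MatrixMultiplication.MatrixMultiplication.Theorems.SoloVal
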